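import Summits.CriticalPhenomena.Ising3DConformalLimit.Theorems.EnergyNotSigmaSquaredEnergyGapSoftRatioRegular

/-!
# `EnergyGapSoft` is EXACTLY adjacent merging — in either pairing; adjacent merging forces ratio regularity
(item stmt-CriticalPhenomena-4473, route `EnergyNotSigmaSquared`; sequel to
`EnergyNotSigmaSquaredEnergyGapSoftRatioRegular`)

Notation: `G = criticalTwoPoint 3`, `e₂ = Pi.single 1 1`, `β_c = criticalBeta 3`,
`P^{A,B}_{β_c} = sourcedDoubleCurrentLawInf 3 (criticalBeta 3) A B`,
`P_par(x) = P^{{0}∆{x},{e₂}∆{x+e₂}}_{β_c}[0 ↔ e₂]`, `P_cross(x) = P^{{0}∆{x+e₂},{e₂}∆{x}}_{β_c}[0 ↔ e₂]`.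

`energyGapSoft_iff_adjacentMerging` (file `…Merging`) read the item as `P_par → 1 ∧ P_cross → 1`, and
`energyGapSoft_iff_parMerging_and_ratioRegular` (file `…RatioRegular`) as
`P_par → 1 ∧ (G(x+e₂)/G(x) → 1)`. Here every conjunction collapses.

* The upper half of the ray argument, through `F = 1/G` (whose ray ceiling is the GKS floor
  `G(x+Ke) ≥ G(Ke)G(x) ≥ cK⁻²G(x)`, `exists_ray_floor_shift`): `inv_ratio_le_of_upperSecondRatio`,
  **`ratioRegular_of_upperSecondRatio_e₂`** — asymptotic log-CONCAVITY `G(y+e₂)G(y-e₂) ≤ (1+η)G(y)²`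
  alone forces ratio regularity for every shift, too;
* `lowerSecondRatio_of_parMerging`, `upperSecondRatio_of_crossMerging` — by Aizenman's tied pairings
  `G(x)² P_par(x) = G(x+e₂)G(x-e₂) P_cross(x)` (ADC21 (3.11)) and `P ≤ 1`, parallel merging gives the
  asymptotic log-convexity and crossed merging the asymptotic log-concavity of `G` in direction `e₂`;
* **`ratioRegular_of_parMerging`, `ratioRegular_of_crossMerging`** — hence EITHER merging statement
  forces `⟨σ₀σ_{x+u}⟩_{β_c}/⟨σ₀σ_x⟩_{β_c} → 1` for every `u` (the open lattice ratio regularity of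
  `MoebiusLimitExists/Negative/RatioRegular.lean`);
* **`energyGapSoft_iff_parMerging`, `energyGapSoft_iff_crossMerging`, `parMerging_iff_crossMerging`** —
  **item 4473 ⟺ `P_par(x) → 1` ⟺ `P_cross(x) → 1` (`‖x‖ → ∞`)**: the truncated critical energy
  correlation on `ℤ³` is `o(⟨σ₀σ_x⟩²)` iff two independent critical sourced currents from the adjacent
  sources `0, e₂` to adjacent far targets merge with probability `→ 1`, for one (equivalently both)
  pairings of the targets. Unconditional and exact — no regularity side condition remains (compare
  `energyGapSoft_iff_parMerging_of_moebiusLimit`, which assumed the crux `MoebiusLimit`).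

Nothing here asserts the item: adjacent merging on `ℤ³` ("ε is not :σ²:") is open. It is expected to
fail for `d ≥ 5`, where the bubble diagram converges (rigorously in high dimension: Aizenman's
tree-diagram bound `|U₄| ≤ 2 Σ_z GGGG` caps `P_par = -U₄/(2G(x)²)` by a multiple of the off-diagonal
bubble), so any proof must use `d = 3` input beyond the soft inequalities (cf. `…NotSoft`).

## References

* M. Aizenman, H. Duminil-Copin, Ann. of Math. 194 (2021), eq. (3.11), Rem. 5.10 [AizenmanDuminilCopinAnnals2021].
* M. Aizenman, Comm. Math. Phys. 86 (1982) 1–48, Prop. 5.2 [AizenmanCMP1982].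
* S. Friedli, Y. Velenik, *Statistical Mechanics of Lattice Systems* (CUP 2017), Thm. 3.20 [FriedliVelenik2017].
-/

noncomputable section

namespace Summit.CriticalPhenomena.Ising3DConformalLimit.EnergyNotSigmaSquaredEnergyGapSoft

open scoped symmDiff
open MeasureTheory Filter Topology
open Literature.Probability.LatticeModels Literature.Probability.Percolation
open Summit.CriticalPhenomena.Ising3DConformalLimit.Theses.EnergyNotSigmaSquared
open Summit.CriticalPhenomena.Ising3DConformalLimit.PinnedClusterPoints (criticalTwoPoint_pos3)

/-! ### The upper half for `G`: asymptotic log-concavity, through `F = 1/G` -/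

/-- **GKS floor on ray ratios**: `G(x) ≤ c⁻¹ K² G(x + K e)` for all `x`, every unit lattice vector `e`
and `K ≥ 1` (`G(x) G(Ke) ≤ G(x + Ke)` and `G(Ke) ≥ cK⁻²`), i.e. the polynomial ray CEILING for `1/G`.
[cite: FriedliVelenik2017, Thm. 3.20, eq. (3.22), p. 109] -/
theorem exists_ray_floor_shift :
    ∃ c : ℝ, 0 < c ∧ ∀ (e : Site 3), ‖e‖ = 1 → ∀ K : ℕ, 1 ≤ K → ∀ x : Site 3,
      criticalTwoPoint 3 x ≤ (K : ℝ) ^ 2 / c * criticalTwoPoint 3 (x + K • e) := by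
  obtain ⟨c, hc, hfloor⟩ := exists_ray_floor
  refine ⟨c, hc, fun e he K hK x => ?_⟩
  have hf := hfloor e he K hK
  have hKpos : (0 : ℝ) < K := by exact_mod_cast hK
  have hK2 : (0 : ℝ) < (K : ℝ) ^ 2 := by positivity
  have hmul := twoPointPlus_mul_le_twoPointPlus (d := 3) (criticalBeta_nonneg 3) x (x + K • e)
  rw [add_sub_cancel_left] at hmul
  change criticalTwoPoint 3 x * criticalTwoPoint 3 (K • e) ≤ criticalTwoPoint 3 (x + K • e) at hmul
  have h0 : 0 ≤ criticalTwoPoint 3 x := criticalTwoPoint_nonneg' _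
  have h1 : criticalTwoPoint 3 x * (c / (K : ℝ) ^ 2) ≤ criticalTwoPoint 3 (x + K • e) :=
    (mul_le_mul_of_nonneg_left hf h0).trans hmul
  rw [mul_div_assoc', div_le_iff₀ hK2] at h1
  rw [div_mul_eq_mul_div, le_div_iff₀ hc]
  linarith

/-- Asymptotic log-concavity along rays is symmetric under `e ↦ -e`. [folklore] -/
theorem upperSecondRatio_neg {e : Site 3}
    (hS : ∀ η : ℝ, 0 < η → ∃ R : ℝ, ∀ y : Site 3, R ≤ ‖y‖ →
      criticalTwoPoint 3 (y + e) * criticalTwoPoint 3 (y - e) ≤ (1 + η) * criticalTwoPoint 3 y ^ 2) :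
    ∀ η : ℝ, 0 < η → ∃ R : ℝ, ∀ y : Site 3, R ≤ ‖y‖ →
      criticalTwoPoint 3 (y + -e) * criticalTwoPoint 3 (y - -e) ≤ (1 + η) * criticalTwoPoint 3 y ^ 2 := by
  intro η hη
  obtain ⟨R, hR⟩ := hS η hη
  refine ⟨R, fun y hy => ?_⟩
  rw [← sub_eq_add_neg, sub_neg_eq_add, mul_comm (criticalTwoPoint 3 (y - e))]
  exact hR y hy

/-- Asymptotic log-concavity of `G` is asymptotic log-convexity of `1/G`. [folklore] -/
theorem lowerSecondRatio_inv_of_upperSecondRatio {e : Site 3}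
    (hS : ∀ η : ℝ, 0 < η → ∃ R : ℝ, ∀ y : Site 3, R ≤ ‖y‖ →
      criticalTwoPoint 3 (y + e) * criticalTwoPoint 3 (y - e) ≤ (1 + η) * criticalTwoPoint 3 y ^ 2) :
    ∀ η : ℝ, 0 < η → ∃ R : ℝ, ∀ y : Site 3, R ≤ ‖y‖ →
      (1 - η) * (criticalTwoPoint 3 y)⁻¹ ^ 2 ≤
        (criticalTwoPoint 3 (y + e))⁻¹ * (criticalTwoPoint 3 (y - e))⁻¹ := by
  have hGpos : ∀ v, 0 < criticalTwoPoint 3 v := criticalTwoPoint_pos3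
  intro η hη
  obtain ⟨R, hR⟩ := hS η hη
  refine ⟨R, fun y hy => ?_⟩
  have h := hR y hy
  have hG2 : 0 < criticalTwoPoint 3 y ^ 2 := pow_pos (hGpos _) 2
  have hW : 0 < criticalTwoPoint 3 (y + e) * criticalTwoPoint 3 (y - e) := mul_pos (hGpos _) (hGpos _)
  rw [← mul_inv, inv_pow, ← div_eq_mul_inv, inv_eq_one_div, div_le_div_iff₀ hG2 hW, one_mul]
  -- `(1 - η) G₊G₋ ≤ G²`
  rcases le_or_gt η 1 with hη1 | hη1
  · calc (1 - η) * (criticalTwoPoint 3 (y + e) * criticalTwoPoint 3 (y - e))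
        ≤ (1 - η) * ((1 + η) * criticalTwoPoint 3 y ^ 2) := mul_le_mul_of_nonneg_left h (by linarith)
      _ = (1 - η ^ 2) * criticalTwoPoint 3 y ^ 2 := by ring
      _ ≤ 1 * criticalTwoPoint 3 y ^ 2 := by
          apply mul_le_mul_of_nonneg_right _ hG2.le; nlinarith [sq_nonneg η]
      _ = _ := one_mul _
  · nlinarith [mul_pos (sub_pos.2 hη1) hW, hG2]

/-- **Asymptotic log-concavity of `G` in a unit direction `e` forces `G(x)/G(x+e) ≤ 1 + δ`
eventually**: the abstract ray argument for `F = 1/G`, whose ceiling is the GKS floor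
(`exists_ray_floor_shift`) and whose asymptotic log-convexity is the log-concavity of `G`.
[cite: AizenmanDuminilCopinAnnals2021, Remark 5.10] -/
theorem inv_ratio_le_of_upperSecondRatio {e : Site 3} (he : ‖e‖ = 1)
    (hS : ∀ η : ℝ, 0 < η → ∃ R : ℝ, ∀ y : Site 3, R ≤ ‖y‖ →
      criticalTwoPoint 3 (y + e) * criticalTwoPoint 3 (y - e) ≤ (1 + η) * criticalTwoPoint 3 y ^ 2)
    (δ : ℝ) (hδ : 0 < δ) :
    ∃ R : ℝ, ∀ x : Site 3, R ≤ ‖x‖ →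
      (criticalTwoPoint 3 (x + e))⁻¹ / (criticalTwoPoint 3 x)⁻¹ ≤ 1 + δ := by
  have hGpos : ∀ v, 0 < criticalTwoPoint 3 v := criticalTwoPoint_pos3
  have hF : ∀ v, 0 < (criticalTwoPoint 3 v)⁻¹ := fun v => inv_pos.2 (hGpos v)
  obtain ⟨c, hc, hfloor⟩ := exists_ray_floor_shift
  have hceil : ∀ K : ℕ, 1 ≤ K → ∀ x : Site 3,
      (criticalTwoPoint 3 (x + K • e))⁻¹ ≤ (K : ℝ) ^ 2 / c * (criticalTwoPoint 3 x)⁻¹ := by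
    intro K hK x
    have h := hfloor e he K hK x
    rw [inv_eq_one_div, inv_eq_one_div, mul_one_div, div_le_div_iff₀ (hGpos _) (hGpos _), one_mul]
    exact h
  exact ratio_le_of_lowerSecondRatio_of_ceiling (F := fun v => (criticalTwoPoint 3 v)⁻¹) he hF hc
    hceil (lowerSecondRatio_inv_of_upperSecondRatio hS) δ hδ

/-- **Asymptotic log-concavity in direction `e₂` forces ratio regularity for every shift `u ∈ ℤ³`**
(ratio regularity of `1/G` in direction `e₂`, inverted, then transported). [cite: AizenmanDuminilCopinAnnals2021, Remark 5.10] -/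
theorem ratioRegular_of_upperSecondRatio_e₂
    (hS : ∀ η : ℝ, 0 < η → ∃ R : ℝ, ∀ y : Site 3, R ≤ ‖y‖ →
      criticalTwoPoint 3 (y + Pi.single 1 1) * criticalTwoPoint 3 (y - Pi.single 1 1) ≤
        (1 + η) * criticalTwoPoint 3 y ^ 2)
    (u : Site 3) :
    Tendsto (fun x : Site 3 => criticalTwoPoint 3 (x + u) / criticalTwoPoint 3 x) cofinite (𝓝 1) := by
  have hGpos : ∀ v, 0 < criticalTwoPoint 3 v := criticalTwoPoint_pos3
  have hF : ∀ v, 0 < (criticalTwoPoint 3 v)⁻¹ := fun v => inv_pos.2 (hGpos v)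
  have he : ‖(Pi.single 1 1 : Site 3)‖ = 1 := by
    rw [Pi.norm_single]; simp
  have he' : ‖-(Pi.single 1 1 : Site 3)‖ = 1 := by rw [norm_neg, he]
  -- ratio regularity of `F = 1/G` in direction `e₂`
  have hnear : ∀ ε : ℝ, 0 < ε → ∃ R : ℝ, ∀ x : Site 3, R ≤ ‖x‖ →
      |(criticalTwoPoint 3 (x + Pi.single 1 1))⁻¹ / (criticalTwoPoint 3 x)⁻¹ - 1| ≤ ε := by
    intro ε hε
    obtain ⟨R₁, hR₁⟩ := inv_ratio_le_of_upperSecondRatio he hS ε hε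
    obtain ⟨R₂, hR₂⟩ := inv_ratio_le_of_upperSecondRatio he' (upperSecondRatio_neg hS) ε hε
    exact ⟨max R₁ (R₂ + 1),
      ratio_near_one_of_two_sides (F := fun v => (criticalTwoPoint 3 v)⁻¹) he hF hε hR₁ hR₂⟩
  have hF2 : Tendsto (fun x : Site 3 =>
      (criticalTwoPoint 3 (x + Pi.single 1 1))⁻¹ / (criticalTwoPoint 3 x)⁻¹) cofinite (𝓝 1) :=
    tendsto_cofinite_of_radius hnear
  -- invert
  have heq : (fun x : Site 3 => criticalTwoPoint 3 (x + Pi.single 1 1) / criticalTwoPoint 3 x) =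
      fun x => ((criticalTwoPoint 3 (x + Pi.single 1 1))⁻¹ / (criticalTwoPoint 3 x)⁻¹)⁻¹ := by
    funext x; rw [inv_div_inv, inv_div]
  have h3 := hF2.inv₀ one_ne_zero
  rw [inv_one] at h3
  have h2 : Tendsto (fun x : Site 3 => criticalTwoPoint 3 (x + Pi.single 1 1) / criticalTwoPoint 3 x)
      cofinite (𝓝 1) := by
    rw [heq]; exact h3
  exact ratioRegular_all_of_ratioRegular_e₂ h2 u

/-! ### Merging gives one-sided second-ratio bounds -/

/-- **Parallel adjacent merging gives asymptotic log-convexity in direction `e₂`**: if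
`P_par(x) ≥ 1 - η` for `‖x‖ ≥ R` then `G(x+e₂)G(x-e₂) ≥ (1-η) G(x)²` there, by the tied pairings
`G(x)² P_par(x) = G(x+e₂)G(x-e₂) P_cross(x)` and `P_cross(x) ≤ 1`. [cite: AizenmanDuminilCopinAnnals2021, eq. (3.11)] -/
theorem lowerSecondRatio_of_parMerging
    (hpar : ∀ ε : ℝ, 0 < ε → ∃ R : ℝ, ∀ x : Site 3, R ≤ ‖x‖ →
      1 - (sourcedDoubleCurrentLawInf 3 (criticalBeta 3) ({0} ∆ {x})
            ({(Pi.single 1 1 : Site 3)} ∆ {x + Pi.single 1 1})).real (openConn 0 (Pi.single 1 1)) ≤ ε) :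
    ∀ η : ℝ, 0 < η → ∃ R : ℝ, ∀ y : Site 3, R ≤ ‖y‖ →
      (1 - η) * criticalTwoPoint 3 y ^ 2 ≤
        criticalTwoPoint 3 (y + Pi.single 1 1) * criticalTwoPoint 3 (y - Pi.single 1 1) := by
  intro η hη
  obtain ⟨R, hR⟩ := hpar η hη
  refine ⟨R, fun y hy => ?_⟩
  have hP := hR y hy
  set Pp := (sourcedDoubleCurrentLawInf 3 (criticalBeta 3) ({0} ∆ {y})
    ({(Pi.single 1 1 : Site 3)} ∆ {y + Pi.single 1 1})).real (openConn 0 (Pi.single 1 1)) with hPp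
  set Pc := (sourcedDoubleCurrentLawInf 3 (criticalBeta 3) ({0} ∆ {y + Pi.single 1 1})
    ({(Pi.single 1 1 : Site 3)} ∆ {y})).real (openConn 0 (Pi.single 1 1)) with hPc
  have hPc1 : Pc ≤ 1 := sourcedDoubleCurrentLawInf_real_le_one _ _ _ _
  have htied := (pairings_tied y).1
  have hG2 : 0 ≤ criticalTwoPoint 3 y ^ 2 := sq_nonneg _
  have hW : 0 ≤ criticalTwoPoint 3 (y + Pi.single 1 1) * criticalTwoPoint 3 (y - Pi.single 1 1) :=
    mul_nonneg (criticalTwoPoint_nonneg' _) (criticalTwoPoint_nonneg' _)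
  calc (1 - η) * criticalTwoPoint 3 y ^ 2 ≤ Pp * criticalTwoPoint 3 y ^ 2 :=
        mul_le_mul_of_nonneg_right (by linarith) hG2
    _ = criticalTwoPoint 3 (y + Pi.single 1 1) * criticalTwoPoint 3 (y - Pi.single 1 1) * Pc := by
        rw [mul_comm]; exact htied
    _ ≤ criticalTwoPoint 3 (y + Pi.single 1 1) * criticalTwoPoint 3 (y - Pi.single 1 1) * 1 :=
        mul_le_mul_of_nonneg_left hPc1 hW
    _ = _ := mul_one _

/-- **Crossed adjacent merging gives asymptotic log-concavity in direction `e₂`**: if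
`P_cross(x) → 1` then `G(x+e₂)G(x-e₂) ≤ (1+η) G(x)²` for `‖x‖ ≥ R(η)`, by the tied pairings and
`P_par(x) ≤ 1` (with `P_cross ≥ 1 - η/(1+η)`, `G₊G₋ ≤ G²/P_cross ≤ (1+η)G²`). [cite: AizenmanDuminilCopinAnnals2021, eq. (3.11)] -/
theorem upperSecondRatio_of_crossMerging
    (hcross : ∀ ε : ℝ, 0 < ε → ∃ R : ℝ, ∀ x : Site 3, R ≤ ‖x‖ →
      1 - (sourcedDoubleCurrentLawInf 3 (criticalBeta 3) ({0} ∆ {x + Pi.single 1 1})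
            ({(Pi.single 1 1 : Site 3)} ∆ {x})).real (openConn 0 (Pi.single 1 1)) ≤ ε) :
    ∀ η : ℝ, 0 < η → ∃ R : ℝ, ∀ y : Site 3, R ≤ ‖y‖ →
      criticalTwoPoint 3 (y + Pi.single 1 1) * criticalTwoPoint 3 (y - Pi.single 1 1) ≤
        (1 + η) * criticalTwoPoint 3 y ^ 2 := by
  intro η hη
  obtain ⟨R, hR⟩ := hcross (η / (1 + η)) (by positivity)
  refine ⟨R, fun y hy => ?_⟩
  have hP := hR y hy
  set Pp := (sourcedDoubleCurrentLawInf 3 (criticalBeta 3) ({0} ∆ {y})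
    ({(Pi.single 1 1 : Site 3)} ∆ {y + Pi.single 1 1})).real (openConn 0 (Pi.single 1 1)) with hPp
  set Pc := (sourcedDoubleCurrentLawInf 3 (criticalBeta 3) ({0} ∆ {y + Pi.single 1 1})
    ({(Pi.single 1 1 : Site 3)} ∆ {y})).real (openConn 0 (Pi.single 1 1)) with hPc
  have hPp1 : Pp ≤ 1 := sourcedDoubleCurrentLawInf_real_le_one _ _ _ _
  have htied := (pairings_tied y).1
  have hG2 : 0 ≤ criticalTwoPoint 3 y ^ 2 := sq_nonneg _
  have hW : 0 ≤ criticalTwoPoint 3 (y + Pi.single 1 1) * criticalTwoPoint 3 (y - Pi.single 1 1) :=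
    mul_nonneg (criticalTwoPoint_nonneg' _) (criticalTwoPoint_nonneg' _)
  -- `P_cross ≥ 1/(1+η)`
  have hPc : 1 / (1 + η) ≤ Pc := by
    have : 1 - η / (1 + η) = 1 / (1 + η) := by field_simp; ring
    linarith
  have hPcpos : 0 < Pc := lt_of_lt_of_le (by positivity) hPc
  -- `G₊G₋ Pc = G² Pp ≤ G²`
  have h1 : criticalTwoPoint 3 (y + Pi.single 1 1) * criticalTwoPoint 3 (y - Pi.single 1 1) * Pc ≤
      criticalTwoPoint 3 y ^ 2 := by
    rw [← htied]
    calc criticalTwoPoint 3 y ^ 2 * Pp ≤ criticalTwoPoint 3 y ^ 2 * 1 :=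
          mul_le_mul_of_nonneg_left hPp1 hG2
      _ = _ := mul_one _
  have h2 : criticalTwoPoint 3 (y + Pi.single 1 1) * criticalTwoPoint 3 (y - Pi.single 1 1) * (1 / (1 + η)) ≤
      criticalTwoPoint 3 y ^ 2 := (mul_le_mul_of_nonneg_left hPc hW).trans h1
  rw [mul_one_div, div_le_iff₀ (by positivity)] at h2
  linarith

/-! ### Merging forces ratio regularity -/

/-- **Parallel adjacent merging forces ratio regularity of `⟨σ₀σ_x⟩_{β_c}` on `ℤ³`**: if the critical
sourced currents `0 → x` and `e₂ → x + e₂` merge with probability `→ 1` as `‖x‖ → ∞`, then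
`⟨σ₀σ_{x+u}⟩_{β_c}/⟨σ₀σ_x⟩_{β_c} → 1` for every fixed `u ∈ ℤ³`. [cite: AizenmanDuminilCopinAnnals2021, eq. (3.11) and Remark 5.10] -/
theorem ratioRegular_of_parMerging
    (hpar : ∀ ε : ℝ, 0 < ε → ∃ R : ℝ, ∀ x : Site 3, R ≤ ‖x‖ →
      1 - (sourcedDoubleCurrentLawInf 3 (criticalBeta 3) ({0} ∆ {x})
            ({(Pi.single 1 1 : Site 3)} ∆ {x + Pi.single 1 1})).real (openConn 0 (Pi.single 1 1)) ≤ ε)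
    (u : Site 3) :
    Tendsto (fun x : Site 3 => criticalTwoPoint 3 (x + u) / criticalTwoPoint 3 x) cofinite (𝓝 1) :=
  ratioRegular_of_lowerSecondRatio_e₂ (lowerSecondRatio_of_parMerging hpar) u

/-- **Crossed adjacent merging forces ratio regularity of `⟨σ₀σ_x⟩_{β_c}` on `ℤ³`** likewise (sourced
currents `0 → x + e₂` and `e₂ → x`). [cite: AizenmanDuminilCopinAnnals2021, eq. (3.11) and Remark 5.10] -/
theorem ratioRegular_of_crossMerging
    (hcross : ∀ ε : ℝ, 0 < ε → ∃ R : ℝ, ∀ x : Site 3, R ≤ ‖x‖ →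
      1 - (sourcedDoubleCurrentLawInf 3 (criticalBeta 3) ({0} ∆ {x + Pi.single 1 1})
            ({(Pi.single 1 1 : Site 3)} ∆ {x})).real (openConn 0 (Pi.single 1 1)) ≤ ε)
    (u : Site 3) :
    Tendsto (fun x : Site 3 => criticalTwoPoint 3 (x + u) / criticalTwoPoint 3 x) cofinite (𝓝 1) :=
  ratioRegular_of_upperSecondRatio_e₂ (upperSecondRatio_of_crossMerging hcross) u

/-! ### The item is adjacent merging, in either pairing -/

/-- **`EnergyGapSoft` ⟺ parallel adjacent merging.** Item 4473 —
`⟨σ₀σ_{e₂}σ_xσ_{x+e₂}⟩_{β_c} - ⟨σ₀σ_{e₂}⟩_{β_c}⟨σ_xσ_{x+e₂}⟩_{β_c} = o(⟨σ₀σ_x⟩²_{β_c})` on `ℤ³` — holds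
iff `P^{{0}∆{x},{e₂}∆{x+e₂}}_{β_c}[0 ↔ e₂] → 1` as `‖x‖ → ∞`. (The ratio-regularity conjunct of
`energyGapSoft_iff_parMerging_and_ratioRegular` is implied by merging.) [cite: AizenmanDuminilCopinAnnals2021, eq. (3.11)] -/
theorem energyGapSoft_iff_parMerging :
    EnergyGapSoft ↔
      ∀ ε : ℝ, 0 < ε → ∃ R : ℝ, ∀ x : Site 3, R ≤ ‖x‖ →
        1 - (sourcedDoubleCurrentLawInf 3 (criticalBeta 3) ({0} ∆ {x})
              ({(Pi.single 1 1 : Site 3)} ∆ {x + Pi.single 1 1})).real (openConn 0 (Pi.single 1 1)) ≤ ε := by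
  rw [energyGapSoft_iff_parMerging_and_ratioRegular]
  exact ⟨fun h => h.1, fun h => ⟨h, ratioRegular_of_parMerging h (Pi.single 1 1)⟩⟩

/-- Crossed adjacent merging forces parallel adjacent merging: `P_par = (G₊G₋/G²) P_cross` with both
factors `→ 1` (ratio regularity from `ratioRegular_of_crossMerging`). [cite: AizenmanDuminilCopinAnnals2021, eq. (3.11)] -/
theorem parMerging_of_crossMerging
    (hcross : ∀ ε : ℝ, 0 < ε → ∃ R : ℝ, ∀ x : Site 3, R ≤ ‖x‖ →
      1 - (sourcedDoubleCurrentLawInf 3 (criticalBeta 3) ({0} ∆ {x + Pi.single 1 1})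
            ({(Pi.single 1 1 : Site 3)} ∆ {x})).real (openConn 0 (Pi.single 1 1)) ≤ ε) :
    ∀ ε : ℝ, 0 < ε → ∃ R : ℝ, ∀ x : Site 3, R ≤ ‖x‖ →
      1 - (sourcedDoubleCurrentLawInf 3 (criticalBeta 3) ({0} ∆ {x})
            ({(Pi.single 1 1 : Site 3)} ∆ {x + Pi.single 1 1})).real (openConn 0 (Pi.single 1 1)) ≤ ε := by
  intro ε hε
  have hsrr := secondRatioRegular_of_ratioRegular_e₂ (ratioRegular_of_crossMerging hcross (Pi.single 1 1))
  obtain ⟨R₁, hR₁⟩ := hsrr (ε / 2) (by positivity)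
  obtain ⟨R₂, hR₂⟩ := hcross (ε / 2) (by positivity)
  refine ⟨max R₁ R₂, fun x hx => ?_⟩
  have h1 := hR₁ x ((le_max_left _ _).trans hx)
  have h2 := hR₂ x ((le_max_right _ _).trans hx)
  set Pp := (sourcedDoubleCurrentLawInf 3 (criticalBeta 3) ({0} ∆ {x})
    ({(Pi.single 1 1 : Site 3)} ∆ {x + Pi.single 1 1})).real (openConn 0 (Pi.single 1 1)) with hPp
  set Pc := (sourcedDoubleCurrentLawInf 3 (criticalBeta 3) ({0} ∆ {x + Pi.single 1 1})
    ({(Pi.single 1 1 : Site 3)} ∆ {x})).real (openConn 0 (Pi.single 1 1)) with hPc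
  have hPc1 : Pc ≤ 1 := sourcedDoubleCurrentLawInf_real_le_one _ _ _ _
  have htied := (pairings_tied x).1
  have hG2 : 0 < criticalTwoPoint 3 x ^ 2 := pow_pos (criticalTwoPoint_pos3 _) 2
  set ρ := criticalTwoPoint 3 (x + Pi.single 1 1) * criticalTwoPoint 3 (x - Pi.single 1 1) /
    criticalTwoPoint 3 x ^ 2 with hρ
  have hρeq : criticalTwoPoint 3 (x + Pi.single 1 1) * criticalTwoPoint 3 (x - Pi.single 1 1) =
      ρ * criticalTwoPoint 3 x ^ 2 := by
    rw [hρ, div_mul_cancel₀ _ hG2.ne']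
  have hkey : Pp = ρ * Pc := by
    have : criticalTwoPoint 3 x ^ 2 * Pp = criticalTwoPoint 3 x ^ 2 * (ρ * Pc) := by
      rw [htied, hρeq]; ring
    exact mul_left_cancel₀ hG2.ne' this
  have hρ1 : 1 - ε / 2 ≤ ρ := by linarith [(abs_le.1 h1).1]
  have hPc2 : 1 - ε / 2 ≤ Pc := by linarith
  rw [hkey]
  rcases le_or_gt (ε / 2) 1 with hε1 | hε1
  · nlinarith [mul_le_mul hρ1 hPc2 (by linarith) (by linarith), sq_nonneg ε]
  · have hρ0 : 0 ≤ ρ :=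
      div_nonneg (mul_nonneg (criticalTwoPoint_nonneg' _) (criticalTwoPoint_nonneg' _)) (sq_nonneg _)
    have : 0 ≤ ρ * Pc := mul_nonneg hρ0 measureReal_nonneg
    linarith

/-- **`EnergyGapSoft` ⟺ crossed adjacent merging** `P^{{0}∆{x+e₂},{e₂}∆{x}}_{β_c}[0 ↔ e₂] → 1`.
[cite: AizenmanDuminilCopinAnnals2021, eq. (3.11)] -/
theorem energyGapSoft_iff_crossMerging :
    EnergyGapSoft ↔
      ∀ ε : ℝ, 0 < ε → ∃ R : ℝ, ∀ x : Site 3, R ≤ ‖x‖ →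
        1 - (sourcedDoubleCurrentLawInf 3 (criticalBeta 3) ({0} ∆ {x + Pi.single 1 1})
              ({(Pi.single 1 1 : Site 3)} ∆ {x})).real (openConn 0 (Pi.single 1 1)) ≤ ε := by
  constructor
  · intro h ε hε
    obtain ⟨R, hR⟩ := energyGapSoft_iff_adjacentMerging.1 h ε hε
    exact ⟨R, fun x hx => (hR x hx).2⟩
  · intro h
    exact energyGapSoft_iff_parMerging.2 (parMerging_of_crossMerging h)

/-- **The two pairings merge together**: `P_par(x) → 1` iff `P_cross(x) → 1` (`‖x‖ → ∞`).
[cite: AizenmanDuminilCopinAnnals2021, eq. (3.11)] -/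
theorem parMerging_iff_crossMerging :
    (∀ ε : ℝ, 0 < ε → ∃ R : ℝ, ∀ x : Site 3, R ≤ ‖x‖ →
        1 - (sourcedDoubleCurrentLawInf 3 (criticalBeta 3) ({0} ∆ {x})
              ({(Pi.single 1 1 : Site 3)} ∆ {x + Pi.single 1 1})).real (openConn 0 (Pi.single 1 1)) ≤ ε) ↔
      ∀ ε : ℝ, 0 < ε → ∃ R : ℝ, ∀ x : Site 3, R ≤ ‖x‖ →
        1 - (sourcedDoubleCurrentLawInf 3 (criticalBeta 3) ({0} ∆ {x + Pi.single 1 1})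
              ({(Pi.single 1 1 : Site 3)} ∆ {x})).real (openConn 0 (Pi.single 1 1)) ≤ ε := by
  rw [← energyGapSoft_iff_parMerging, energyGapSoft_iff_crossMerging]

/-! ### Spin-only form: the adjacent Ursell function saturates Aizenman's bound -/

/-- The adjacent lattice Ursell function is `-2 G(x)² P_par(x)`:
`⟨σ₀σ_{e₂}σ_xσ_{x+e₂}⟩ - (G(e₂)² + G(x)² + G(x+e₂)G(x-e₂)) = -2 G(x)² P_par(x)`. [cite: AizenmanDuminilCopinAnnals2021, eq. (3.11)] -/
theorem adjacentUrsell_eq (x : Site 3) :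
    criticalCorr 3 4 ![0, (Pi.single 1 1 : Site 3), x, x + Pi.single 1 1] -
        (criticalTwoPoint 3 (Pi.single 1 1) ^ 2 + criticalTwoPoint 3 x ^ 2 +
          criticalTwoPoint 3 (x + Pi.single 1 1) * criticalTwoPoint 3 (x - Pi.single 1 1)) =
      -2 * criticalTwoPoint 3 x ^ 2 *
        (sourcedDoubleCurrentLawInf 3 (criticalBeta 3) ({0} ∆ {x})
          ({(Pi.single 1 1 : Site 3)} ∆ {x + Pi.single 1 1})).real (openConn 0 (Pi.single 1 1)) := by
  have h := adjacentTruncation_eq_ursell x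
  rw [criticalCorr_two_pair, criticalCorr_two_pair, sub_zero, add_sub_cancel_left] at h
  linear_combination h

/-- **`EnergyGapSoft` ⟺ the adjacent Ursell function is asymptotically `-2⟨σ₀σ_x⟩²`** (spins only, no
currents): item 4473 holds iff for every `ε > 0`, eventually in `‖x‖`,
`U₄(0, e₂, x, x+e₂) ≤ -(2 - ε)⟨σ₀σ_x⟩²_{β_c}` — Aizenman's Gaussian bound
`|U₄| ≤ 2⟨σ₀σ_x⟩⟨σ_{e₂}σ_{x+e₂}⟩` is saturated at adjacent quadruples (`U₄ = -2G(x)²P_par(x)` and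
`energyGapSoft_iff_parMerging`). [cite: AizenmanCMP1982, Prop. 5.2] -/
theorem energyGapSoft_iff_ursellSaturation :
    EnergyGapSoft ↔
      ∀ ε : ℝ, 0 < ε → ∃ R : ℝ, ∀ x : Site 3, R ≤ ‖x‖ →
        criticalCorr 3 4 ![0, (Pi.single 1 1 : Site 3), x, x + Pi.single 1 1] -
            (criticalTwoPoint 3 (Pi.single 1 1) ^ 2 + criticalTwoPoint 3 x ^ 2 +
              criticalTwoPoint 3 (x + Pi.single 1 1) * criticalTwoPoint 3 (x - Pi.single 1 1)) ≤
          -((2 - ε) * criticalTwoPoint 3 x ^ 2) := by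
  rw [energyGapSoft_iff_parMerging]
  constructor
  · intro h ε hε
    obtain ⟨R, hR⟩ := h (ε / 2) (by positivity)
    refine ⟨R, fun x hx => ?_⟩
    rw [adjacentUrsell_eq]
    have hP := hR x hx
    have hG2 : 0 ≤ criticalTwoPoint 3 x ^ 2 := sq_nonneg _
    nlinarith [mul_le_mul_of_nonneg_left hP hG2]
  · intro h ε hε
    obtain ⟨R, hR⟩ := h (2 * ε) (by positivity)
    refine ⟨R, fun x hx => ?_⟩
    have hU := hR x hx
    rw [adjacentUrsell_eq] at hU
    have hG2 : 0 < criticalTwoPoint 3 x ^ 2 := pow_pos (criticalTwoPoint_pos3 _) 2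
    by_contra hlt
    push Not at hlt
    nlinarith [mul_lt_mul_of_pos_right hlt hG2]

end Summit.CriticalPhenomena.Ising3DConformalLimit.EnergyNotSigmaSquaredEnergyGapSoft

end
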